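import Summits.CriticalPhenomena.PercolationContinuityZ3.Theorems.PercNearOneGluingNoHeavyQuantTLCShiftedTarget
import HarnessLib

/-!
# QUANT lane R8, the node G₁ for a GENERAL partner, part 3: the FIXED-PARTNER CERTIFICATE PRINCIPLE for a product top-low-capacity row —
# a conic combination of the big factor's single-threshold rows plus one mean tilt that dominates the pull-back proves the row

builds on p205010 (kernel theorem, internal audit signed; external expert review pending)

Support file (`--supports stmt-CriticalPhenomena-4575`), QUANT lane seat prim-quant-arm-2 (gen 40), rung R8 of
`run/shared/lean/prim/quant/LADDER.md`; memo `run/shared/lean/prim/quant/prim-quant-arm-2-g40/G1-GENERAL-G40.md` §2/§5.  Theorems only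
(no definitions), standard axioms, no sorries.  Parts 1–2: `…QuantTLCShiftedTarget` (shifted-target decomposition, no-low partner), `…QuantTLCNaturalLayer`
(layer monotonicity, one strongest row per threshold).

THE PRINCIPLE (q = 1; the one-sided analogue, with a mean tilt, of arm-2 g38's tensor-certificate principle `…QuantTwoLayerCertificate`).  Floor
`0 < y < 1` (`u = y/(1−y)`); `μ₁ ≥ 0` on `{0..M₁}` with mass `1` and mean `T₁`, satisfying in functional form every single-threshold row `(j′, t)`
(`t ≤ j′`, `2t < T₁`) at target `T₁` — for a top-affordable probability law with `LawDec.TLC` this is part 1's `tlcRow_functional_all_layers`;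
`μ₂ ≥ 0` arbitrary on `{0..M₂}`; a product row `(j, i)` at target `T₁ + T₂` (`i ≤ j`, `T₂` any real) with coefficients
`c′(n) = u[n ≤ i] − [j+1 ≤ n] − u[n ≤ j ∧ T₁+T₂ < i+n]/usage y (T₁+T₂) j i n` and PULL-BACK `e(a) = Σ_{k ≤ M₂} μ₂(k)·c′(a+k)`.
A CERTIFICATE is a finite family of rows `(j′_r, t_r)` of `μ₁` with weights `w_r ≥ 0` and one tilt `λ ∈ ℝ` such that POINTWISE on `a ≤ M₁`
  `e(a) ≤ Σ_r w_r · C^{j′_r, t_r}_{T₁}(a) + λ·(T₁ − a)`.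
THEN `Σ_h c′(h)·(lconv M₁ M₂ μ₁ μ₂)(h) ≤ 0` (**`lconv_tlcRow_functional_of_certificate`**), i.e. the product satisfies the row `(j, i)`
(**`lconv_tlcRow_of_certificate`**, the `LawDec.TLC`-shaped body, from the `TLC` + TA + mass hypotheses on `μ₁`).  Proof: test the row against the
convolution (`Σ_h c′ ν = Σ_a μ₁(a) e(a)`, `sum_fun_mul_lconv_pullback`), dominate pointwise, and use `Σ_a μ₁(a) C_r(a) ≤ 0` (rows) and
`Σ_a μ₁(a)(T₁ − a) = 0` (mass and mean, `sum_mul_tilt_eq_zero`).  By LP duality this is also NECESSARY for a fixed partner: the product row `(j,i)` holds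
for every admissible `μ₁` iff such a certificate exists (with `TLC2` rows of `μ₁` allowed in the family); the exact anatomy of memo §3 (≈ 240 000 product
rows in ≈ 1 300 cells: a pure tilt or the CANONICAL pure-`TLC` certificate of part 2 in all but ≈ 900 rows, which need `TLC2` rows and all belong to blob-like
partners `{0: 1−g, m: g}`).  This file is the landing pad for explicit certificates: instantiate `w`, `λ`, prove the pointwise inequality.
HONEST STATUS: G₁ (`TLC2GateConvTLC`), SGC and `Quant.FarTreeRow` (light) remain OPEN; nothing here is cited as a published result; the lane's RATE
class log\* and honest sentence (`run/shared/lean/prim/quant/README.md`) are unchanged.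

[this work]; part 1 (`tlc_functional_sum`, `tlcRow_functional_all_layers`): this seat; `TLC`: prim-quant-census-2 g64; flows / usage: prim-quant-stmt g22
(this lane).  LP duality for finitely generated cones is classical; nothing here is cited as a published result.  The gluing rows served
[cite: KozmaNitzan2024, Conjecture 3 (p. 15)]; product measure [cite: Grimmett1999, §1.3 p. 10].
-/

noncomputable section

namespace Summit.CriticalPhenomena.PercolationContinuityZ3.Theorems

namespace Quant

open Finset

namespace LawDec

/-- bookkeeping: a test function against the convolution, grouped by the atoms of the FIRST factor:
`Σ_{h ≤ M₁+M₂} φ h·lconv μ₁ μ₂ h = Σ_{a ≤ M₁} μ₁ a · Σ_{k ≤ M₂} μ₂ k·φ(a+k)`. [this work] -/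
theorem sum_fun_mul_lconv_pullback (M₁ M₂ : ℕ) (μ₁ μ₂ : ℕ → ℝ) (φ : ℕ → ℝ) :
    ∑ h ∈ Finset.range (M₁ + M₂ + 1), φ h * lconv M₁ M₂ μ₁ μ₂ h
      = ∑ a ∈ Finset.range (M₁ + 1), μ₁ a * ∑ k ∈ Finset.range (M₂ + 1), μ₂ k * φ (a + k) := by
  simp only [lconv, Finset.mul_sum]
  rw [Finset.sum_comm]
  refine Finset.sum_congr rfl fun a ha => ?_
  rw [Finset.sum_comm]
  refine Finset.sum_congr rfl fun s hs => ?_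
  rw [Finset.mem_range] at ha hs
  have e : ∀ h : ℕ, φ h * (if a + s = h then μ₁ a * μ₂ s else 0) = if a + s = h then μ₁ a * (μ₂ s * φ (a + s)) else 0 := by
    intro h
    split_ifs with hh
    · rw [hh]; ring
    · rw [mul_zero]
  simp_rw [e]
  rw [Finset.sum_ite_eq (Finset.range (M₁ + M₂ + 1)) (a + s), if_pos (Finset.mem_range.2 (by omega))]

/-- **the mean tilt is free**: mass `1` and mean `T₁` on `{0..M₁}` give `Σ_a μ₁(a)·(T₁ − a) = 0`. [this work] -/
theorem sum_mul_tilt_eq_zero (M₁ : ℕ) (μ₁ : ℕ → ℝ) (T₁ : ℝ) (h11 : ∑ a ∈ Finset.range (M₁ + 1), μ₁ a = 1)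
    (hT1 : ∑ a ∈ Finset.range (M₁ + 1), (a : ℝ) * μ₁ a = T₁) :
    ∑ a ∈ Finset.range (M₁ + 1), μ₁ a * (T₁ - a) = 0 := by
  have e : ∀ a : ℕ, μ₁ a * (T₁ - a) = T₁ * μ₁ a - (a : ℝ) * μ₁ a := fun a => by ring
  simp_rw [e]
  rw [Finset.sum_sub_distrib, ← Finset.mul_sum, h11, hT1, mul_one, sub_self]

/-- bookkeeping: a law tested against 'conic combination of rows plus tilt' splits into the rows' sums and the tilt's sum. [this work] -/
theorem sum_mul_certificate {ι : Type} [Fintype ι] (s : Finset ℕ) (μ : ℕ → ℝ) (w : ι → ℝ) (C : ι → ℕ → ℝ) (lam T : ℝ) :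
    ∑ a ∈ s, μ a * (∑ r, w r * C r a + lam * (T - a)) = ∑ r, w r * ∑ a ∈ s, C r a * μ a + lam * ∑ a ∈ s, μ a * (T - a) := by
  have e : ∀ a ∈ s, μ a * (∑ r, w r * C r a + lam * (T - a)) = ∑ r, w r * (C r a * μ a) + lam * (μ a * (T - a)) := by
    intro a _
    rw [mul_add, Finset.mul_sum]
    congr 1
    · exact Finset.sum_congr rfl fun r _ => by ring
    · ring
  rw [Finset.sum_congr rfl e, Finset.sum_add_distrib, Finset.sum_comm]
  congr 1
  · exact Finset.sum_congr rfl fun r _ => by rw [Finset.mul_sum]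
  · rw [Finset.mul_sum]

/-- **THE FIXED-PARTNER CERTIFICATE PRINCIPLE, functional form.**  `μ₁ ≥ 0` with mass `1`, mean `T₁` and all single-threshold rows at `T₁` (functional
form, every layer); `μ₂ ≥ 0`; a finite family of rows `(lay r, thr r)` (`thr r ≤ lay r`, `2·thr r < T₁`) with weights `w r ≥ 0` and a tilt `lam` dominating the
pull-back of the product row `(j, i)` at target `T₁ + T₂` pointwise on `{0..M₁}`.  Then the product row holds in functional form. [this work] -/
theorem lconv_tlcRow_functional_of_certificate {ι : Type} [Fintype ι] (y T₁ T₂ : ℝ) (M₁ M₂ j i : ℕ) (μ₁ μ₂ : ℕ → ℝ)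
    (w : ι → ℝ) (lay thr : ι → ℕ) (lam : ℝ)
    (h10 : ∀ a, 0 ≤ μ₁ a) (h11 : ∑ a ∈ Finset.range (M₁ + 1), μ₁ a = 1)
    (hT1 : ∑ a ∈ Finset.range (M₁ + 1), (a : ℝ) * μ₁ a = T₁)
    (hrows : ∀ j' i' : ℕ, i' ≤ j' → 2 * (i' : ℝ) < T₁ →
      ∑ a ∈ Finset.range (M₁ + 1), (y / (1 - y) * (if a ≤ i' then (1 : ℝ) else 0) - (if j' + 1 ≤ a then (1 : ℝ) else 0)
        - y / (1 - y) * (if a ≤ j' ∧ T₁ < (i' : ℝ) + a then 1 / usage y T₁ j' i' a else 0)) * μ₁ a ≤ 0)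
    (hw : ∀ r, 0 ≤ w r) (hthr : ∀ r, thr r ≤ lay r ∧ 2 * ((thr r : ℕ) : ℝ) < T₁)
    (hcert : ∀ a : ℕ, a ≤ M₁ →
      ∑ k ∈ Finset.range (M₂ + 1), μ₂ k *
          (y / (1 - y) * (if a + k ≤ i then (1 : ℝ) else 0) - (if j + 1 ≤ a + k then (1 : ℝ) else 0)
            - y / (1 - y) * (if a + k ≤ j ∧ T₁ + T₂ < (i : ℝ) + ((a + k : ℕ) : ℝ) then 1 / usage y (T₁ + T₂) j i (a + k) else 0))
        ≤ ∑ r, w r * (y / (1 - y) * (if a ≤ thr r then (1 : ℝ) else 0) - (if lay r + 1 ≤ a then (1 : ℝ) else 0)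
            - y / (1 - y) * (if a ≤ lay r ∧ T₁ < ((thr r : ℕ) : ℝ) + a then 1 / usage y T₁ (lay r) (thr r) a else 0))
          + lam * (T₁ - a)) :
    ∑ h ∈ Finset.range (M₁ + M₂ + 1), (y / (1 - y) * (if h ≤ i then (1 : ℝ) else 0) - (if j + 1 ≤ h then (1 : ℝ) else 0)
        - y / (1 - y) * (if h ≤ j ∧ T₁ + T₂ < (i : ℝ) + h then 1 / usage y (T₁ + T₂) j i h else 0))
        * lconv M₁ M₂ μ₁ μ₂ h ≤ 0 := by
  rw [sum_fun_mul_lconv_pullback]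
  -- dominate pointwise
  have hdom : ∑ a ∈ Finset.range (M₁ + 1), μ₁ a * ∑ k ∈ Finset.range (M₂ + 1), μ₂ k *
        (y / (1 - y) * (if a + k ≤ i then (1 : ℝ) else 0) - (if j + 1 ≤ a + k then (1 : ℝ) else 0)
          - y / (1 - y) * (if a + k ≤ j ∧ T₁ + T₂ < (i : ℝ) + ((a + k : ℕ) : ℝ) then 1 / usage y (T₁ + T₂) j i (a + k) else 0))
      ≤ ∑ a ∈ Finset.range (M₁ + 1), μ₁ a * (∑ r, w r * (y / (1 - y) * (if a ≤ thr r then (1 : ℝ) else 0) - (if lay r + 1 ≤ a then (1 : ℝ) else 0)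
            - y / (1 - y) * (if a ≤ lay r ∧ T₁ < ((thr r : ℕ) : ℝ) + a then 1 / usage y T₁ (lay r) (thr r) a else 0))
          + lam * (T₁ - a)) :=
    Finset.sum_le_sum fun a ha => mul_le_mul_of_nonneg_left (hcert a (Nat.lt_succ_iff.1 (Finset.mem_range.1 ha))) (h10 a)
  refine le_trans hdom ?_
  -- split the certificate: rows + tilt
  have key := sum_mul_certificate (Finset.range (M₁ + 1)) μ₁ w
    (fun (r : ι) (a : ℕ) => y / (1 - y) * (if a ≤ thr r then (1 : ℝ) else 0) - (if lay r + 1 ≤ a then (1 : ℝ) else 0)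
      - y / (1 - y) * (if a ≤ lay r ∧ T₁ < ((thr r : ℕ) : ℝ) + a then 1 / usage y T₁ (lay r) (thr r) a else 0)) lam T₁
  beta_reduce at key
  rw [key, sum_mul_tilt_eq_zero M₁ μ₁ T₁ h11 hT1, mul_zero, add_zero]
  refine Finset.sum_nonpos fun r _ => ?_
  have hr := hrows (lay r) (thr r) (hthr r).1 (hthr r).2
  have := mul_nonneg (hw r) (neg_nonneg.2 hr)
  linarith

/-- **THE FIXED-PARTNER CERTIFICATE PRINCIPLE, `LawDec.TLC` form.**  `0 < y < 1`; `μ₁` a top-affordable probability law on `{0..M₁}` (mean `T₁`) with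
`TLC y T₁ M₁ μ₁`; `μ₂ ≥ 0`; a product row `(j, i)` with `i ≤ j ≤ M₁ + M₂` and a certificate as above (rows of `μ₁` at ANY layer, weights `≥ 0`, one tilt).
Then the body of the `LawDec.TLC` row `(j, i)` of `lconv M₁ M₂ μ₁ μ₂` at target `T₁ + T₂` holds. [this work] -/
theorem lconv_tlcRow_of_certificate {ι : Type} [Fintype ι] (y T₂ : ℝ) (M₁ M₂ j i : ℕ) (μ₁ μ₂ : ℕ → ℝ)
    (w : ι → ℝ) (lay thr : ι → ℕ) (lam : ℝ)
    (hy0 : 0 < y) (hy1 : y < 1)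
    (h10 : ∀ a, 0 ≤ μ₁ a) (h1M : ∀ a, M₁ < a → μ₁ a = 0) (h11 : ∑ a ∈ Finset.range (M₁ + 1), μ₁ a = 1)
    (h1T : y * (M₁ : ℝ) ≤ ∑ a ∈ Finset.range (M₁ + 1), (a : ℝ) * μ₁ a)
    (hTLC : TLC y (∑ a ∈ Finset.range (M₁ + 1), (a : ℝ) * μ₁ a) M₁ μ₁)
    (hij : i ≤ j) (hjM : j ≤ M₁ + M₂)
    (hw : ∀ r, 0 ≤ w r) (hthr : ∀ r, thr r ≤ lay r ∧ 2 * ((thr r : ℕ) : ℝ) < ∑ a ∈ Finset.range (M₁ + 1), (a : ℝ) * μ₁ a)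
    (hcert : ∀ a : ℕ, a ≤ M₁ →
      ∑ k ∈ Finset.range (M₂ + 1), μ₂ k *
          (y / (1 - y) * (if a + k ≤ i then (1 : ℝ) else 0) - (if j + 1 ≤ a + k then (1 : ℝ) else 0)
            - y / (1 - y) * (if a + k ≤ j ∧ (∑ a ∈ Finset.range (M₁ + 1), (a : ℝ) * μ₁ a) + T₂ < (i : ℝ) + ((a + k : ℕ) : ℝ) then
                1 / usage y ((∑ a ∈ Finset.range (M₁ + 1), (a : ℝ) * μ₁ a) + T₂) j i (a + k) else 0))
        ≤ ∑ r, w r * (y / (1 - y) * (if a ≤ thr r then (1 : ℝ) else 0) - (if lay r + 1 ≤ a then (1 : ℝ) else 0)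
            - y / (1 - y) * (if a ≤ lay r ∧ (∑ a ∈ Finset.range (M₁ + 1), (a : ℝ) * μ₁ a) < ((thr r : ℕ) : ℝ) + a then
                1 / usage y (∑ a ∈ Finset.range (M₁ + 1), (a : ℝ) * μ₁ a) (lay r) (thr r) a else 0))
          + lam * ((∑ a ∈ Finset.range (M₁ + 1), (a : ℝ) * μ₁ a) - a)) :
    y / (1 - y) * ∑ l ∈ Finset.range (i + 1), lconv M₁ M₂ μ₁ μ₂ l
      ≤ ∑ h ∈ Finset.range (M₁ + M₂ + 1), (if j + 1 ≤ h then lconv M₁ M₂ μ₁ μ₂ h else 0)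
        + y / (1 - y) * ∑ h ∈ Finset.range (M₁ + M₂ + 1),
            (if h ≤ j ∧ (∑ a ∈ Finset.range (M₁ + 1), (a : ℝ) * μ₁ a) + T₂ < (i : ℝ) + h then
              lconv M₁ M₂ μ₁ μ₂ h / usage y ((∑ a ∈ Finset.range (M₁ + 1), (a : ℝ) * μ₁ a) + T₂) j i h else 0) := by
  set T₁ : ℝ := ∑ a ∈ Finset.range (M₁ + 1), (a : ℝ) * μ₁ a with hT₁
  have hfun := lconv_tlcRow_functional_of_certificate y T₁ T₂ M₁ M₂ j i μ₁ μ₂ w lay thr lam h10 h11 rfl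
    (fun j' i' hij' hlow' => tlcRow_functional_all_layers y M₁ μ₁ hy0 hy1 h10 h1M h11 h1T hTLC j' i' hij' hlow') hw hthr hcert
  rw [tlc_functional_sum y (T₁ + T₂) (M₁ + M₂) i j (lconv M₁ M₂ μ₁ μ₂) (by omega)] at hfun
  linarith

end LawDec

end Quant

end Summit.CriticalPhenomena.PercolationContinuityZ3.Theorems
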